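import Literature.Computability.AlgebraicComplexity.GroupAlgebraRankBounds
import Literature.RepresentationTheory.FiniteGroups.DicyclicCharacterDegrees
import Literature.RepresentationTheory.FiniteGroups.GeneralizedDihedralCharacterDegrees
import HarnessLib

/-!
# `rk ℂ[G] = 2|G| − T(G)` for groups with an abelian subgroup of index `≤ 2`: dicyclic and generalized dihedral groups (Pospelov 2011, Thm. 6 (1); instances)

Topic `Literature/Computability/AlgebraicComplexity` (family `MatrixMultiplication`); a sequel of
`GroupAlgebraRankBounds.lean` (Pospelov 2011 Thm. 6 (1) = HHMM 2013 Thm. 3.1 (i)(ii):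
`Pospelov2011_thm6_1 : b(G) ≤ 2 → R(G) + k(G) = 2|G|`, and its dihedral instances
`Pospelov2011_rank_dihedralGroup_odd/_even`).

Source: A. Pospelov, *Group-theoretic lower bounds for the complexity of matrix multiplication*,
TAMC 2011, LNCS 6648, 2–13 [Pospelov2011], §3 Thm. 6 (1) (held PDF p. 15 L11–p. 16): "`T₃(G) = 0` iff
`k[G]` is of minimal rank. In this case `rk k[G] = t₁(G) + 7t₂(G)`" (`tᵢ(G)` = number of irreducible
characters of degree `i`; so `rk ℂ[G] = 2|G| − T(G)` whenever every irreducible degree is `≤ 2`), and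
Cor. 3 (5) ("A non-abelian `p_n`-group with an abelian subgroup of index `p_n`") for the shape of the
hypothesis; J.-P. Serre, *Linear Representations of Finite Groups*, §3.1, Cor. to Thm. 9 (an abelian
subgroup of index `m` forces all irreducible degrees `≤ m`; tree `charDegree_le_index`,
`charDegrees_le_two_of_index_le_two`) [Serre1977]; the character tables of the dicyclic groups
`T_{4n}` (James–Liebeck, Exercise 17.6 / 18.3; tree `DicyclicCharacterDegrees.lean`) [JamesLiebeck2001]
and of the generalized dihedral groups `Dih(A) = A ⋊ C₂`, `|A|` odd (Isaacs, Problem 2.18; tree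
`GeneralizedDihedralCharacterDegrees.lean`) [Isaacs1976].

## What is formalised (everything PROVED; no definitions, no named facts)

* `Pospelov2011_thm6_1_of_index_le_two` — if `G` has an abelian subgroup `A` of index `≤ 2`, then
  `R(ℂ[G]) + k(G) = 2|G|` (Thm. 6 (1) with `b(G) ≤ 2` from Serre's corollary).
* `Pospelov2011_rank_quaternionGroup` — the dicyclic groups `T_{4n} = QuaternionGroup n` (`n ≥ 1`,
  order `4n`, `k = n + 3`): `R(ℂ[T_{4n}]) + (n + 3) = 8n`, i.e. `rk = t₁ + 7t₂ = 4 + 7(n−1)`;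
  `Pospelov2011_rank_quaternionGroup_two` — `R(ℂ[Q₈]) = 11`.
* `Pospelov2011_rank_generalizedDihedral` — `Dih(A) = A ⋊ C₂` with `|A|` odd (order `2|A|`,
  `k = 2 + (|A|−1)/2`): `R(ℂ[Dih(A)]) + (2 + (|A|−1)/2) = 4|A|`.

## References
* [Pospelov2011] A. Pospelov, TAMC 2011, LNCS 6648, §3 Thm. 6 (1), Cor. 3.
* [Serre1977] J.-P. Serre, *Linear Representations of Finite Groups*, §3.1 Cor. to Thm. 9 — via the tree.
* [JamesLiebeck2001] G. James, M. Liebeck, *Representations and Characters of Groups*, Ex. 17.6 —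
  via the tree.
* [Isaacs1976] I. M. Isaacs, *Character Theory of Finite Groups*, Problem 2.18 — via the tree.
-/

noncomputable section

namespace Literature.Computability.AlgebraicComplexity

open Literature.RepresentationTheory.FiniteGroups

variable {G : Type} [Group G]

/-- **Pospelov 2011, Thm. 6 (1), for groups with an abelian subgroup of index `≤ 2`**: then every
irreducible degree is `≤ 2` (Serre §3.1, Cor. to Thm. 9; tree `charDegrees_le_two_of_index_le_two`),
so `T₃(G) = 0` and `rk ℂ[G] = t₁(G) + 7t₂(G) = 2|G| − T(G)`, here subtraction-free
`R(G) + k(G) = 2|G|` (tree `Pospelov2011_thm6_1`). [cite: Pospelov2011, Thm. 6]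
[cite: Serre1977, §3.1 Cor. to Thm. 9] -/
theorem Pospelov2011_thm6_1_of_index_le_two [Fintype G] [DecidableEq G] (A : Subgroup G)
    [IsMulCommutative A] (hA : A.index ≤ 2) :
    tensorRank (groupTensor ℂ G) + Nat.card (ConjClasses G) = 2 * Fintype.card G :=
  Pospelov2011_thm6_1 (csSup_le (charDegrees_nonempty (G := G)) fun _ hd =>
    charDegrees_le_two_of_index_le_two A hA hd)

/-- **The dicyclic groups**: `R(ℂ[T_{4n}]) + (n + 3) = 8n` for `T_{4n} = QuaternionGroup n`, `n ≥ 1`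
(`|T_{4n}| = 4n`, `k(T_{4n}) = n + 3`, every irreducible degree `≤ 2` — tree
`QuaternionGroup.card_conjClasses`, `QuaternionGroup.charDegree_le_two`), i.e. Pospelov's
`rk = t₁ + 7t₂ = 4 + 7(n − 1)`. [cite: Pospelov2011, Thm. 6]
[cite: JamesLiebeck2001, Exercise 17.6 (solution, p. 420)] -/
theorem Pospelov2011_rank_quaternionGroup {n : ℕ} [NeZero n] :
    tensorRank (groupTensor ℂ (QuaternionGroup n)) + (n + 3) = 8 * n := by
  have hb : maxCharDegree (QuaternionGroup n) ≤ 2 :=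
    csSup_le (charDegrees_nonempty (G := QuaternionGroup n)) fun _ hd =>
      QuaternionGroup.charDegree_le_two hd
  have h := Pospelov2011_thm6_1 (G := QuaternionGroup n) hb
  rw [QuaternionGroup.card_conjClasses, QuaternionGroup.card] at h
  omega

/-- In particular **`R(ℂ[Q₈]) = 11`** for the quaternion group `Q₈ = T₈` (`16 − 5`).
[cite: Pospelov2011, Thm. 6] [cite: JamesLiebeck2001, Exercise 17.6 (solution, p. 420)] -/
theorem Pospelov2011_rank_quaternionGroup_two :
    tensorRank (groupTensor ℂ (QuaternionGroup 2)) = 11 := by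
  have h := Pospelov2011_rank_quaternionGroup (n := 2)
  omega

/-- **The generalized dihedral groups**: for a finite abelian group `A` of odd order,
`R(ℂ[Dih(A)]) + (2 + (|A| − 1)/2) = 4|A|` for `Dih(A) = A ⋊ C₂` (`|Dih(A)| = 2|A|`,
`k = 2 + (|A|−1)/2`, every irreducible degree `≤ 2` — tree `GeneralizedDihedral.card_conjClasses_dih`,
`GeneralizedDihedral.charDegree_dih`), i.e. `rk = t₁ + 7t₂ = 2 + 7(|A| − 1)/2`.
[cite: Pospelov2011, Thm. 6] [cite: Isaacs1976, Problem 2.18] -/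
theorem Pospelov2011_rank_generalizedDihedral (A : Type) [CommGroup A] [Fintype A]
    [Fintype (GeneralizedDihedral.Dih A)] [DecidableEq (GeneralizedDihedral.Dih A)]
    (hA : Odd (Nat.card A)) :
    tensorRank (groupTensor ℂ (GeneralizedDihedral.Dih A)) + (2 + (Nat.card A - 1) / 2) =
      4 * Nat.card A := by
  have hb : maxCharDegree (GeneralizedDihedral.Dih A) ≤ 2 := by
    refine csSup_le (charDegrees_nonempty (G := GeneralizedDihedral.Dih A)) fun d hd => ?_
    obtain ⟨χ, hχ, hχd⟩ := exists_isIrrChar_of_mem_charDegrees hd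
    rcases GeneralizedDihedral.charDegree_dih A hA hχ with h1 | h2
    · rw [h1] at hχd
      have : d = 1 := by exact_mod_cast hχd.symm
      omega
    · rw [h2] at hχd
      have : d = 2 := by exact_mod_cast hχd.symm
      omega
  have h := Pospelov2011_thm6_1 (G := GeneralizedDihedral.Dih A) hb
  have hcard : Fintype.card (GeneralizedDihedral.Dih A) = 2 * Nat.card A := by
    rw [← Nat.card_eq_fintype_card, GeneralizedDihedral.Dih, SemidirectProduct.card, Nat.card_eq_fintype_card
      (α := Multiplicative (ZMod 2)), Fintype.card_multiplicative, ZMod.card]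
    ring
  rw [GeneralizedDihedral.card_conjClasses_dih A hA, hcard] at h
  omega

end Literature.Computability.AlgebraicComplexity

end
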